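import Summits.Ventures.HodgeRepro2.T5BergmanCoeffL2

/-!
# The `L²`-theory of the matrix coefficients, II: the `K`-type expansion of `∫ |⟨π_k(g) f, h⟩_k|² dμ`

Fix `k ≥ 2`, `h ∈ A_k` and a Haar measure `μ` on `SU(1,1)`; write `c_f(g) = ⟨π_k(g) f, h⟩_k` and
`Q(f) = ∫ |c_f|² dμ`. The main theorem (`hasSum_integral_norm_matrixCoeff_sq`) is the **expansion along
the `K`-types**: for holomorphic `f = Σ a_m zᵐ ∈ A_k` with `c_f ∈ L²(μ)`,

  `Q(f) = Σ_m |a_m|² Q(zᵐ)`   (as a `HasSum`),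

and conversely `c_f ∈ L²(μ)` as soon as the right-hand side converges
(`integrable_norm_matrixCoeff_sq_of_summable`). The two halves:

* **Fatou** (`lintegral_norm_matrixCoeff_sq_le`): `∫⁻ |c_f|² ≤ Σ_m |a_m|² Q(zᵐ)` — the Taylor polynomials
  `S_N f` converge to `f` in `A_k`, so `c_{S_N f} → c_f` pointwise, and `Q(S_N f) = Σ_{m<N} |a_m|² Q(zᵐ)`
  (`T5BergmanCoeffOrtho.integral_norm_matrixCoeff_partialSum_sq`);
* **Bessel** (`sum_le_integral_norm_matrixCoeff_sq`): `Σ_{m<N} |a_m|² Q(zᵐ) ≤ Q(f)` — the cross term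
  `∫ c_{S_N f} conj c_{f - S_N f} dμ` vanishes (`integral_partialSum_mul_conj_sub_eq_zero`): after
  `K`-averaging (`T5BergmanCoeffL2.integral_integral_mul_rot`) only the `K`-types `m < N` of `f - S_N f`
  survive, and those are zero.

Blind lane: Mathlib + the HodgeRepro2 prefix only; no sorry; axioms ⊆ {propext, Classical.choice,
Quot.sound}.
-/

namespace Summit.Ventures.HodgeRepro2.T5BergmanCoeffExpansion

open MeasureTheory MeasureTheory.Measure Metric Filter Topology
open T5PoincareDensity T5SU11Unimodular T5SU11Fibration T5HaarCircle
open T5BergmanCoefficient T5BergmanPairing T5BergmanUnitary T5BergmanFourier T5BergmanKernel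
  T5BergmanParseval T5BergmanPointwise T5BergmanProjection T5BergmanCoefficientL2 T5BergmanKTypes
  T5BergmanActStable T5BergmanMatrixCoeff T5BergmanCoeffOrtho T5BergmanSchur T5BergmanCoeffL2
open scoped Real ENNReal

variable [MeasurableSpace Circle] [BorelSpace Circle]

/-! ### Fatou: the upper bound -/

/-- **Fatou's lemma for the coefficients**: for holomorphic `f = Σ a_m zᵐ ∈ A_k`,
`∫⁻ |c_f|² dμ ≤ Σ_m |a_m|² ∫ |c_{zᵐ}|² dμ` (in `[0, ∞]`). -/
theorem lintegral_norm_matrixCoeff_sq_le (μ : Measure SU11) [IsHaarMeasure μ] (k : ℕ) (hk : 2 ≤ k)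
    (a : ℕ → ℂ) (f : ℂ → ℂ) (hf : DifferentiableOn ℂ f (ball 0 1))
    (hfa : ∀ w ∈ ball (0 : ℂ) 1, HasSum (fun m => a m * w ^ m) (f w))
    (hfint : IntegrableOn (fun w => ‖f w‖ ^ 2 * (1 - ‖w‖ ^ 2) ^ (k - 2)) (ball (0 : ℂ) 1))
    (b : ℕ → ℂ) (h : ℂ → ℂ) (hh : ∀ w ∈ ball (0 : ℂ) 1, HasSum (fun n => b n * w ^ n) (h w))
    (hhint : IntegrableOn (fun w => ‖h w‖ ^ 2 * (1 - ‖w‖ ^ 2) ^ (k - 2)) (ball (0 : ℂ) 1)) :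
    ∫⁻ g, ENNReal.ofReal (‖matrixCoeff k f h g‖ ^ 2) ∂μ ≤
      ∑' m, ENNReal.ofReal (‖a m‖ ^ 2 * ∫ g, ‖matrixCoeff k (fun w => w ^ m) h g‖ ^ 2 ∂μ) := by
  have hhc : ContinuousOn h (ball 0 1) := continuousOn_ball b h hh
  have hm2 := integrable_norm_matrixCoeff_monomial_sq μ k hk b h hh hhint
  set F : ℕ → SU11 → ℝ≥0∞ := fun N g => ENNReal.ofReal (‖matrixCoeff k (partialSum a N) h g‖ ^ 2)
    with hF
  -- pointwise convergence
  have hpt : ∀ g, Tendsto (fun N => F N g) atTop (𝓝 (ENNReal.ofReal (‖matrixCoeff k f h g‖ ^ 2))) := by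
    intro g
    refine (ENNReal.continuous_ofReal.tendsto _).comp ?_
    refine ((continuous_norm.pow 2).tendsto _).comp ?_
    rw [tendsto_iff_norm_sub_tendsto_zero]
    have h1 := (tendsto_pairing_sub_partialSum k hk a f hfa hfint).mul_const (pairing k h h).re
    rw [zero_mul] at h1
    have h2 := h1.sqrt
    rw [Real.sqrt_zero] at h2
    refine squeeze_zero (fun N => norm_nonneg _) (fun N => ?_) h2
    rw [norm_sub_rev]
    exact norm_matrixCoeff_sub_partialSum_left_le k hk a f hf hfa hfint h hhc hhint N g
  have hmeas : ∀ N, Measurable (F N) := fun N =>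
    ((continuous_matrixCoeff_partialSum k hk a N b h hh hhint).norm.pow 2).measurable.ennreal_ofReal
  have hlim : (fun g => ENNReal.ofReal (‖matrixCoeff k f h g‖ ^ 2)) =
      fun g => liminf (fun N => F N g) atTop := funext fun g => ((hpt g).liminf_eq).symm
  rw [hlim]
  refine (lintegral_liminf_le hmeas).trans (le_of_eq ?_)
  -- the integrals of the Taylor polynomials
  have e : ∀ N, ∫⁻ g, F N g ∂μ =
      ∑ m ∈ Finset.range N, ENNReal.ofReal (‖a m‖ ^ 2 * ∫ g, ‖matrixCoeff k (fun w => w ^ m) h g‖ ^ 2 ∂μ) := by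
    intro N
    rw [hF]
    simp only
    rw [← ofReal_integral_eq_lintegral_ofReal
      (integrable_norm_matrixCoeff_partialSum_sq μ k hk a N b h hh hhint hm2)
      (Eventually.of_forall fun g => by positivity),
      integral_norm_matrixCoeff_partialSum_sq μ k hk a N b h hh hhint hm2,
      ENNReal.ofReal_sum_of_nonneg]
    intro m _
    exact mul_nonneg (by positivity) (integral_nonneg fun g => by positivity)
  simp_rw [e]
  exact (ENNReal.tendsto_nat_tsum _).liminf_eq

/-! ### Bessel: the lower bound -/

omit [MeasurableSpace Circle] [BorelSpace Circle] in
/-- `|x - y|² ≤ 2|x|² + 2|y|²`. -/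
lemma norm_sub_sq_le (x y : ℂ) : ‖x - y‖ ^ 2 ≤ 2 * ‖x‖ ^ 2 + 2 * ‖y‖ ^ 2 := by
  have h1 : ‖x - y‖ ^ 2 ≤ (‖x‖ + ‖y‖) ^ 2 := pow_le_pow_left₀ (norm_nonneg _) (norm_sub_le x y) 2
  nlinarith [sq_nonneg (‖x‖ - ‖y‖)]

/-- **The cross term vanishes**: `∫ c_{S_N f} conj c_{f - S_N f} dμ = 0` for holomorphic `f ∈ A_k` with
`c_f ∈ L²(μ)`. -/
theorem integral_partialSum_mul_conj_sub_eq_zero (μ : Measure SU11) [IsHaarMeasure μ] (k : ℕ)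
    (hk : 2 ≤ k) (a : ℕ → ℂ) (f : ℂ → ℂ) (hf : DifferentiableOn ℂ f (ball 0 1))
    (hfa : ∀ w ∈ ball (0 : ℂ) 1, HasSum (fun m => a m * w ^ m) (f w))
    (hfint : IntegrableOn (fun w => ‖f w‖ ^ 2 * (1 - ‖w‖ ^ 2) ^ (k - 2)) (ball (0 : ℂ) 1))
    (b : ℕ → ℂ) (h : ℂ → ℂ) (hh : ∀ w ∈ ball (0 : ℂ) 1, HasSum (fun n => b n * w ^ n) (h w))
    (hhint : IntegrableOn (fun w => ‖h w‖ ^ 2 * (1 - ‖w‖ ^ 2) ^ (k - 2)) (ball (0 : ℂ) 1))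
    (hf2 : Integrable (fun g => ‖matrixCoeff k f h g‖ ^ 2) μ) (N : ℕ) :
    ∫ g, matrixCoeff k (partialSum a N) h g *
      (starRingEnd ℂ) (matrixCoeff k (f - partialSum a N) h g) ∂μ = 0 := by
  have hhc : ContinuousOn h (ball 0 1) := continuousOn_ball b h hh
  have hm2 := integrable_norm_matrixCoeff_monomial_sq μ k hk b h hh hhint
  have hS : DifferentiableOn ℂ (partialSum a N) (ball 0 1) :=
    (differentiable_partialSum a N).differentiableOn
  set P := matrixCoeff k (partialSum a N) h with hP
  set T := matrixCoeff k (f - partialSum a N) h with hT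
  have hPc : Continuous P := continuous_matrixCoeff_partialSum k hk a N b h hh hhint
  have hfc : Continuous (matrixCoeff k f h) := continuous_matrixCoeff k hk a f hf hfa hfint b h hh hhint
  have hTeq : ∀ g, T g = matrixCoeff k f h g - P g := fun g =>
    matrixCoeff_sub_left k hk f (partialSum a N) h hf hfint hS (integrableOn_partialSum k a N) hhc
      hhint g
  have hTc : Continuous T := by
    have : T = fun g => matrixCoeff k f h g - P g := funext hTeq
    rw [this]
    exact hfc.sub hPc
  have hP2 : Integrable (fun g => ‖P g‖ ^ 2) μ :=
    integrable_norm_matrixCoeff_partialSum_sq μ k hk a N b h hh hhint hm2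
  have hT2 : Integrable (fun g => ‖T g‖ ^ 2) μ := by
    refine ((hf2.const_mul 2).add (hP2.const_mul 2)).mono' (hTc.norm.pow 2).aestronglyMeasurable
      (Eventually.of_forall fun g => ?_)
    rw [Real.norm_eq_abs, abs_of_nonneg (by positivity), hTeq]
    exact norm_sub_sq_le _ _
  have hΦ : Integrable (fun g => P g * (starRingEnd ℂ) (T g)) μ := integrable_mul_conj hPc hTc hP2 hT2
  have hΦc : Continuous fun g => P g * (starRingEnd ℂ) (T g) :=
    hPc.mul (Complex.continuous_conj.comp hTc)
  rw [← integral_integral_mul_rot μ hΦc hΦ]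
  -- the inner integral vanishes for every `g`
  have hinner : ∀ g, ∫ u, P (g * rot u) * (starRingEnd ℂ) (T (g * rot u)) ∂haarCircle = 0 := by
    intro g
    have hTsub : DifferentiableOn ℂ (f - partialSum a N) (ball 0 1) := hf.sub hS
    have hTint := integrableOn_sub_partialSum k hk a f hfa hfint N
    have e : ∀ u : Circle, P (g * rot u) * (starRingEnd ℂ) (T (g * rot u)) =
        ∑ m ∈ Finset.range N, (a m * matrixCoeff k (fun w => w ^ m) h g) *
          (starRingEnd ℂ) ((u : ℂ) ^ (k + 2 * m) * T (g * rot u)) := by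
      intro u
      rw [hP, matrixCoeff_partialSum_mul_rot k hk a N h hhc hhint, Finset.sum_mul]
      refine Finset.sum_congr rfl fun m _ => ?_
      rw [map_mul, conj_pow]
      ring
    simp_rw [e]
    rw [integral_finsetSum]
    · refine Finset.sum_eq_zero fun m hm => ?_
      rw [integral_const_mul, integral_conj, hT,
        integral_circle_pow_mul_matrixCoeff k hk _ (f - partialSum a N) hTsub
          (fun w hw => hasSum_sub_partialSum a f hfa N hw) hTint b h hh hhint m g,
        if_pos (Finset.mem_range.mp hm), zero_mul, map_zero, mul_zero]
    · intro m _
      refine Integrable.const_mul ?_ _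
      refine integrable_circle_of_continuous (Complex.continuous_conj.comp ?_)
      exact (by fun_prop : Continuous fun u : Circle => (u : ℂ) ^ (k + 2 * m)).mul
        (hTc.comp (continuous_const.mul continuous_rot))
  simp_rw [hinner]
  exact integral_zero _ _

/-- **Bessel's inequality for the coefficients**: `Σ_{m<N} |a_m|² ∫ |c_{zᵐ}|² dμ ≤ ∫ |c_f|² dμ` for
holomorphic `f = Σ a_m zᵐ ∈ A_k` with `c_f ∈ L²(μ)`. -/
theorem sum_le_integral_norm_matrixCoeff_sq (μ : Measure SU11) [IsHaarMeasure μ] (k : ℕ) (hk : 2 ≤ k)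
    (a : ℕ → ℂ) (f : ℂ → ℂ) (hf : DifferentiableOn ℂ f (ball 0 1))
    (hfa : ∀ w ∈ ball (0 : ℂ) 1, HasSum (fun m => a m * w ^ m) (f w))
    (hfint : IntegrableOn (fun w => ‖f w‖ ^ 2 * (1 - ‖w‖ ^ 2) ^ (k - 2)) (ball (0 : ℂ) 1))
    (b : ℕ → ℂ) (h : ℂ → ℂ) (hh : ∀ w ∈ ball (0 : ℂ) 1, HasSum (fun n => b n * w ^ n) (h w))
    (hhint : IntegrableOn (fun w => ‖h w‖ ^ 2 * (1 - ‖w‖ ^ 2) ^ (k - 2)) (ball (0 : ℂ) 1))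
    (hf2 : Integrable (fun g => ‖matrixCoeff k f h g‖ ^ 2) μ) (N : ℕ) :
    ∑ m ∈ Finset.range N, ‖a m‖ ^ 2 * ∫ g, ‖matrixCoeff k (fun w => w ^ m) h g‖ ^ 2 ∂μ ≤
      ∫ g, ‖matrixCoeff k f h g‖ ^ 2 ∂μ := by
  have hhc : ContinuousOn h (ball 0 1) := continuousOn_ball b h hh
  have hm2 := integrable_norm_matrixCoeff_monomial_sq μ k hk b h hh hhint
  have hS : DifferentiableOn ℂ (partialSum a N) (ball 0 1) :=
    (differentiable_partialSum a N).differentiableOn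
  set P := matrixCoeff k (partialSum a N) h with hP
  set T := matrixCoeff k (f - partialSum a N) h with hT
  have hPc : Continuous P := continuous_matrixCoeff_partialSum k hk a N b h hh hhint
  have hfc : Continuous (matrixCoeff k f h) := continuous_matrixCoeff k hk a f hf hfa hfint b h hh hhint
  have hTeq : ∀ g, matrixCoeff k f h g = P g + T g := fun g => by
    rw [hT, matrixCoeff_sub_left k hk f (partialSum a N) h hf hfint hS (integrableOn_partialSum k a N)
      hhc hhint g]
    ring
  have hTc : Continuous T := by
    have : T = fun g => matrixCoeff k f h g - P g := funext fun g => by rw [hTeq g]; ring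
    rw [this]
    exact hfc.sub hPc
  have hP2 : Integrable (fun g => ‖P g‖ ^ 2) μ :=
    integrable_norm_matrixCoeff_partialSum_sq μ k hk a N b h hh hhint hm2
  have hT2 : Integrable (fun g => ‖T g‖ ^ 2) μ := by
    refine ((hf2.const_mul 2).add (hP2.const_mul 2)).mono' (hTc.norm.pow 2).aestronglyMeasurable
      (Eventually.of_forall fun g => ?_)
    rw [Real.norm_eq_abs, abs_of_nonneg (by positivity)]
    have : T g = matrixCoeff k f h g - P g := by rw [hTeq g]; ring
    rw [this]
    exact norm_sub_sq_le _ _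
  have hΦ : Integrable (fun g => P g * (starRingEnd ℂ) (T g)) μ := integrable_mul_conj hPc hTc hP2 hT2
  have hcross := integral_partialSum_mul_conj_sub_eq_zero μ k hk a f hf hfa hfint b h hh hhint hf2 N
  -- `|P + T|² = |P|² + |T|² + 2 Re (P T̄)`
  have e : ∀ g, ‖matrixCoeff k f h g‖ ^ 2 =
      ‖P g‖ ^ 2 + ‖T g‖ ^ 2 + 2 * (P g * (starRingEnd ℂ) (T g)).re := by
    intro g
    rw [hTeq g, ← Complex.normSq_eq_norm_sq, ← Complex.normSq_eq_norm_sq,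
      ← Complex.normSq_eq_norm_sq, Complex.normSq_add]
  rw [← integral_norm_matrixCoeff_partialSum_sq μ k hk a N b h hh hhint hm2]
  have hT0 : 0 ≤ ∫ g, ‖T g‖ ^ 2 ∂μ := integral_nonneg fun g => sq_nonneg _
  have hPT : Integrable (fun g => ‖P g‖ ^ 2 + ‖T g‖ ^ 2) μ := hP2.add hT2
  have hRe : Integrable (fun g => 2 * (P g * (starRingEnd ℂ) (T g)).re) μ := hΦ.re.const_mul 2
  have hre0 : ∫ g, (P g * (starRingEnd ℂ) (T g)).re ∂μ = 0 := by
    have h1 := integral_re hΦ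
    simp only [RCLike.re_to_complex] at h1
    rw [h1, hP, hT, hcross, Complex.zero_re]
  have hint_eq : ∫ g, ‖matrixCoeff k f h g‖ ^ 2 ∂μ = ∫ g, ‖P g‖ ^ 2 ∂μ + ∫ g, ‖T g‖ ^ 2 ∂μ := by
    simp_rw [e]
    rw [integral_add hPT hRe, integral_add hP2 hT2, integral_const_mul, hre0, mul_zero, add_zero]
  rw [hint_eq]
  linarith

/-! ### The `K`-type expansion -/

/-- **The `K`-type expansion of `∫ |⟨π_k(g) f, h⟩_k|² dμ`**: for holomorphic `f = Σ a_m zᵐ ∈ A_k` and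
`h ∈ A_k` with `c_f ∈ L²(μ)`, `∫ |c_f|² dμ = Σ_m |a_m|² ∫ |c_{zᵐ}|² dμ`. -/
theorem hasSum_integral_norm_matrixCoeff_sq (μ : Measure SU11) [IsHaarMeasure μ] (k : ℕ) (hk : 2 ≤ k)
    (a : ℕ → ℂ) (f : ℂ → ℂ) (hf : DifferentiableOn ℂ f (ball 0 1))
    (hfa : ∀ w ∈ ball (0 : ℂ) 1, HasSum (fun m => a m * w ^ m) (f w))
    (hfint : IntegrableOn (fun w => ‖f w‖ ^ 2 * (1 - ‖w‖ ^ 2) ^ (k - 2)) (ball (0 : ℂ) 1))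
    (b : ℕ → ℂ) (h : ℂ → ℂ) (hh : ∀ w ∈ ball (0 : ℂ) 1, HasSum (fun n => b n * w ^ n) (h w))
    (hhint : IntegrableOn (fun w => ‖h w‖ ^ 2 * (1 - ‖w‖ ^ 2) ^ (k - 2)) (ball (0 : ℂ) 1))
    (hf2 : Integrable (fun g => ‖matrixCoeff k f h g‖ ^ 2) μ) :
    HasSum (fun m => ‖a m‖ ^ 2 * ∫ g, ‖matrixCoeff k (fun w => w ^ m) h g‖ ^ 2 ∂μ)
      (∫ g, ‖matrixCoeff k f h g‖ ^ 2 ∂μ) := by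
  set q : ℕ → ℝ := fun m => ‖a m‖ ^ 2 * ∫ g, ‖matrixCoeff k (fun w => w ^ m) h g‖ ^ 2 ∂μ with hq
  have hq0 : ∀ m, 0 ≤ q m := fun m => mul_nonneg (by positivity) (integral_nonneg fun g => by positivity)
  have hbessel : ∀ N, ∑ m ∈ Finset.range N, q m ≤ ∫ g, ‖matrixCoeff k f h g‖ ^ 2 ∂μ := fun N =>
    sum_le_integral_norm_matrixCoeff_sq μ k hk a f hf hfa hfint b h hh hhint hf2 N
  have hsum : Summable q := summable_of_sum_range_le hq0 hbessel
  have hle : ∑' m, q m ≤ ∫ g, ‖matrixCoeff k f h g‖ ^ 2 ∂μ := Real.tsum_le_of_sum_range_le hq0 hbessel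
  have hge : ∫ g, ‖matrixCoeff k f h g‖ ^ 2 ∂μ ≤ ∑' m, q m := by
    have h1 := lintegral_norm_matrixCoeff_sq_le μ k hk a f hf hfa hfint b h hh hhint
    rw [← ofReal_integral_eq_lintegral_ofReal hf2 (Eventually.of_forall fun g => by positivity),
      ← ENNReal.ofReal_tsum_of_nonneg hq0 hsum] at h1
    exact (ENNReal.ofReal_le_ofReal_iff (tsum_nonneg hq0)).mp h1
  have : ∑' m, q m = ∫ g, ‖matrixCoeff k f h g‖ ^ 2 ∂μ := le_antisymm hle hge
  rw [← this]
  exact hsum.hasSum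

/-- **Square-integrability from the `K`-type expansion**: if `Σ_m |a_m|² ∫ |c_{zᵐ}|² dμ` converges then
`c_f ∈ L²(μ)`. -/
theorem integrable_norm_matrixCoeff_sq_of_summable (μ : Measure SU11) [IsHaarMeasure μ] (k : ℕ)
    (hk : 2 ≤ k) (a : ℕ → ℂ) (f : ℂ → ℂ) (hf : DifferentiableOn ℂ f (ball 0 1))
    (hfa : ∀ w ∈ ball (0 : ℂ) 1, HasSum (fun m => a m * w ^ m) (f w))
    (hfint : IntegrableOn (fun w => ‖f w‖ ^ 2 * (1 - ‖w‖ ^ 2) ^ (k - 2)) (ball (0 : ℂ) 1))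
    (b : ℕ → ℂ) (h : ℂ → ℂ) (hh : ∀ w ∈ ball (0 : ℂ) 1, HasSum (fun n => b n * w ^ n) (h w))
    (hhint : IntegrableOn (fun w => ‖h w‖ ^ 2 * (1 - ‖w‖ ^ 2) ^ (k - 2)) (ball (0 : ℂ) 1))
    (hsum : Summable fun m => ‖a m‖ ^ 2 * ∫ g, ‖matrixCoeff k (fun w => w ^ m) h g‖ ^ 2 ∂μ) :
    Integrable (fun g => ‖matrixCoeff k f h g‖ ^ 2) μ := by
  have hfc : Continuous (matrixCoeff k f h) := continuous_matrixCoeff k hk a f hf hfa hfint b h hh hhint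
  have hq0 : ∀ m, 0 ≤ ‖a m‖ ^ 2 * ∫ g, ‖matrixCoeff k (fun w => w ^ m) h g‖ ^ 2 ∂μ := fun m =>
    mul_nonneg (by positivity) (integral_nonneg fun g => by positivity)
  refine ⟨(hfc.norm.pow 2).aestronglyMeasurable, ?_⟩
  rw [hasFiniteIntegral_iff_ofReal (Eventually.of_forall fun g => by positivity)]
  refine (lintegral_norm_matrixCoeff_sq_le μ k hk a f hf hfa hfint b h hh hhint).trans_lt ?_
  rw [← ENNReal.ofReal_tsum_of_nonneg hq0 hsum]
  exact ENNReal.ofReal_lt_top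

end Summit.Ventures.HodgeRepro2.T5BergmanCoeffExpansion
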